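import Mathlib
import Summits.KontsevichZagierPeriods.Zeta5Search.Families.DualQSeriesBridge
import Summits.KontsevichZagierPeriods.Zeta5Search.Families.DualExactBridge
import Summits.KontsevichZagierPeriods.Zeta5Search.Families.DualConstantTermSum
import Summits.KontsevichZagierPeriods.Zeta5Search.Families.GaussCongruence
import HarnessLib
import HarnessLib.Audit

/-!
# ζ(5) search — Families: **P2 g6's CONJECTURE D-exact is a theorem** (`LeadingCoeffIsDualConstantTerm` holds)

HONEST FRAMING: systematic search; no irrationality claim unless certified.  Cell `pub-zeta5`, certifier 2
(cert-2 g8, 2026-08-22).  An identity between integers attached to Brown–Zudilin's cellular integrals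
(`|Q(a)|` of their (17) = the constant term `dualConstantTerm a` of P2 g6's dual Laurent polynomial) on the whole cone
`bzNum a ≥ 0`, `bzDen a ≥ 0`; it says NOTHING about `ζ(5)` and moves no record of the search.

The half-cone `h₂₇ ≥ 0` was settled in `Families/DualExactUnconditional` (polynomial family `G`).  On the other half
(`h₂₇ < 0`, e.g. `a = (0,1,1,0,2,0,1,0)`) the exponent `e₁ = h₂₇` of `1+v` is negative; both sides of the
twelve-parameter identity extend to `e₁ ∈ ℤ` (`Families/DualQSeries`: `Gz = PhiZ`), Brown–Zudilin's `|Q|` is `Gz` on the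
whole numerator cone (`Families/DualQSeriesBridge.abs_QOf_eq_Gz`: on the support of (17) the truncation of `zchoose`
never bites), and here `PhiZ (h₂₇ a) (e(a)) (t(a)) = dualConstantTerm a` (`PhiZ_eq_dualConstantTerm`, from
`PhiZ_eq_coeff` = `DualExactBridge.Phi_eq_coeff` verbatim with `e₁ ∈ ℤ`).  Hence

**`leadingCoeffIsDualConstantTerm_holds : LeadingCoeffIsDualConstantTerm`** and the pointwise form **`dexact_cone`**;
the tree's three results that took the conjecture as a hypothesis are discharged (`abs_QOf_mul_prod_le`,
`abs_QOf_ray_le` — `|Q(n·a)| ≤ Λ_a(g)ⁿ` for every `g > 0`, the `limsup` half of P2's Conjecture D —, `abs_QOf_ray_gauss`).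

Mechanism (memo `HOME/cert-2/g8/DEXACT12.md`): `|Q|` and the dual constant term are the constant terms of one Laurent
monomial in two charts of the torus of gap ratios of eight points on a line, related by six cluster flips
(`DualGapFlipStep`, `DualBaseChartsA/B`); the induction on the exponents (`DualExactTwelve`, `DualQSeries`) transports the
monomial case to all exponents.
-/

noncomputable section

open MvPolynomial Finset

namespace Summit.KontsevichZagierPeriods.Zeta5Search.Families.Cellular

namespace DualR

open Literature.NumberTheory.Irrationality
open Literature.NumberTheory.Irrationality.BrownZudilin2022 (QOf)
open DualQ (eOfA tOfA)

/-- **`PhiZ e₁ e t = [g^{B(e,t)}] ∏_S L_S^{n_S}`** (`n = nExpZ e₁ e t`) whenever all ten span exponents and all six gap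
exponents are non-negative — `Families/DualExactBridge.Phi_eq_coeff` with `e₁ ∈ ℤ`. -/
theorem PhiZ_eq_coeff (e₁ : ℤ) (e : Fin 7 → ℕ) (t : Fin 5 → ℤ) (hn : ∀ k, 0 ≤ nExpZ e₁ e t k)
    (hB : ∀ w, 0 ≤ Bvec e t w) :
    PhiZ e₁ e t = coeff (Finsupp.equivFunOnFinite.symm fun w => (Bvec e t w).toNat)
      (tenProd fun k => (nExpZ e₁ e t k).toNat) := by
  have en : ∀ k, (((nExpZ e₁ e t k).toNat : ℕ) : ℤ) = nExpZ e₁ e t k := fun k => Int.toNat_of_nonneg (hn k)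
  have eb : ∀ w, (((Bvec e t w).toNat : ℕ) : ℤ) = Bvec e t w := fun w => Int.toNat_of_nonneg (hB w)
  have hE : ((E (nExpZ e₁ e t) : S5ˣ) : S5) = (tenProdQ (fun k => (nExpZ e₁ e t k).toNat) : S5) := by
    have hnE : nExpZ e₁ e t = fun k => (((nExpZ e₁ e t k).toNat : ℕ) : ℤ) := by funext k; rw [en k]
    conv_lhs => rw [hnE]
    exact E_val_eq_coe _
  -- the component identity behind the bookkeeping: `θ̂(B) = M(n) + (0, c)` whenever `c ≥ 0`
  have comp : (∀ j, 0 ≤ cExp e t j) → ∀ i : Fin 6,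
      thetaHat (Finsupp.equivFunOnFinite.symm fun w => (Bvec e t w).toNat) i =
        monoExp (fun k => (nExpZ e₁ e t k).toNat) i +
          (Finsupp.mapDomain Fin.succ (Finsupp.equivFunOnFinite.symm fun j => (cExp e t j).toNat) : Fin 6 →₀ ℕ) i := by
    intro hc i
    have ec : ∀ j, (((cExp e t j).toNat : ℕ) : ℤ) = cExp e t j := fun j => Int.toNat_of_nonneg (hc j)
    have hsucc : ∀ j : Fin 5, (Finsupp.mapDomain Fin.succ
        (Finsupp.equivFunOnFinite.symm fun j => (cExp e t j).toNat) : Fin 6 →₀ ℕ) (Fin.succ j) = (cExp e t j).toNat :=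
      fun j => by rw [Finsupp.mapDomain_apply (Fin.succ_injective _), Finsupp.coe_equivFunOnFinite_symm]
    fin_cases i
    · have h0 : (0 : Fin 6) ∉ Set.range (Fin.succ : Fin 5 → Fin 6) := by simp
      rw [show (⟨0, by norm_num⟩ : Fin 6) = 0 from rfl, Finsupp.mapDomain_notin_range (f := Fin.succ) _ 0 h0]
      simp only [thetaHat, monoExp, Finsupp.coe_equivFunOnFinite_symm, Matrix.cons_val_zero, add_zero]
      zify
      simp only [en, eb]
      simp only [nExpZ, Bvec, Matrix.cons_val_zero, Matrix.cons_val_one, Matrix.cons_val]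
      omega
    · rw [show (⟨1, by norm_num⟩ : Fin 6) = Fin.succ 0 from rfl, hsucc]
      simp only [thetaHat, monoExp, Finsupp.coe_equivFunOnFinite_symm, Fin.succ_zero_eq_one, Matrix.cons_val_one,
        Matrix.cons_val_zero]
      zify
      simp only [en, eb, ec]
      simp only [nExpZ, Bvec, cExp, Matrix.cons_val_zero, Matrix.cons_val_one, Matrix.cons_val]
      omega
    · rw [show (⟨2, by norm_num⟩ : Fin 6) = Fin.succ 1 from rfl, hsucc]
      simp only [thetaHat, monoExp, Finsupp.coe_equivFunOnFinite_symm, Fin.succ_one_eq_two, Matrix.cons_val]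
      zify
      simp only [en, eb, ec]
      simp only [nExpZ, Bvec, cExp, Matrix.cons_val_one, Matrix.cons_val]
      omega
    · rw [show (⟨3, by norm_num⟩ : Fin 6) = Fin.succ 2 from rfl, hsucc]
      simp only [thetaHat, monoExp, Finsupp.coe_equivFunOnFinite_symm, Matrix.cons_val_succ, Matrix.cons_val]
      zify
      simp only [en, eb, ec]
      simp only [nExpZ, Bvec, cExp, Matrix.cons_val]
      omega
    · rw [show (⟨4, by norm_num⟩ : Fin 6) = Fin.succ 3 from rfl, hsucc]
      simp only [thetaHat, monoExp, Finsupp.coe_equivFunOnFinite_symm, Matrix.cons_val_succ, Matrix.cons_val]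
      zify
      simp only [en, eb, ec]
      simp only [nExpZ, Bvec, cExp, Matrix.cons_val]
      omega
    · rw [show (⟨5, by norm_num⟩ : Fin 6) = Fin.succ 4 from rfl, hsucc]
      simp only [thetaHat, monoExp, Finsupp.coe_equivFunOnFinite_symm, Matrix.cons_val_succ, Matrix.cons_val, zero_add]
      zify
      simp only [eb, ec]
      simp only [Bvec, cExp, Matrix.cons_val]
  rw [← coeff_theta, theta_tenProd, coeff_monomial_mul']
  unfold PhiZ coeffZ
  by_cases hc : ∀ j, 0 ≤ cExp e t j
  · have hle : monoExp (fun k => (nExpZ e₁ e t k).toNat) ≤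
        thetaHat (Finsupp.equivFunOnFinite.symm fun w => (Bvec e t w).toNat) :=
      Finsupp.le_def.2 fun i => by rw [comp hc i]; exact Nat.le_add_right _ _
    have hidx : thetaHat (Finsupp.equivFunOnFinite.symm fun w => (Bvec e t w).toNat) -
        monoExp (fun k => (nExpZ e₁ e t k).toNat) =
        Finsupp.mapDomain Fin.succ (Finsupp.equivFunOnFinite.symm fun j => (cExp e t j).toNat) := by
      ext i; rw [Finsupp.tsub_apply, comp hc i, add_tsub_cancel_left]
    rw [if_pos hc, if_pos hle, one_mul, hidx, coeff_rename_mapDomain _ (Fin.succ_injective _), hE,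
      MvPolynomial.coeff_coe]
  · rw [if_neg hc]
    by_cases hle : monoExp (fun k => (nExpZ e₁ e t k).toNat) ≤
        thetaHat (Finsupp.equivFunOnFinite.symm fun w => (Bvec e t w).toNat)
    · exfalso
      apply hc
      have hle' := Finsupp.le_def.1 hle
      have h1 := hle' 1; have h2 := hle' 2; have h3 := hle' 3; have h4 := hle' 4; have h5 := hle' 5
      simp only [thetaHat, monoExp, Finsupp.coe_equivFunOnFinite_symm, Matrix.cons_val_zero, Matrix.cons_val_one,
        Matrix.cons_val] at h1 h2 h3 h4 h5
      zify at h1 h2 h3 h4 h5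
      simp only [en, eb] at h1 h2 h3 h4 h5
      simp only [nExpZ, Bvec, Matrix.cons_val_zero, Matrix.cons_val_one, Matrix.cons_val] at h1 h2 h3 h4 h5
      intro j
      fin_cases j
      · rw [show (⟨0, by norm_num⟩ : Fin 5) = 0 from rfl]; simp only [cExp, Matrix.cons_val_zero]; omega
      · rw [show (⟨1, by norm_num⟩ : Fin 5) = 1 from rfl]; simp only [cExp, Matrix.cons_val_one, Matrix.cons_val_zero]
        omega
      · rw [show (⟨2, by norm_num⟩ : Fin 5) = 2 from rfl]; simp only [cExp, Matrix.cons_val]; omega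
      · rw [show (⟨3, by norm_num⟩ : Fin 5) = 3 from rfl]; simp only [cExp, Matrix.cons_val]; omega
      · rw [show (⟨4, by norm_num⟩ : Fin 5) = 4 from rfl]; simp only [cExp, Matrix.cons_val]; omega
    · rw [if_neg hle]

/-- On Brown–Zudilin's family the ten span exponents of `nExpZ (h₂₇ a)` are `(0, A₇, A₆, A₀, A₁, 0, A₃, A₂, 0, 0)` —
for EVERY `a` with `bzNum a ≥ 0` (no sign condition on `h₂₇`). -/
theorem nExpZ_eOfA (a : Fin 8 → ℤ) (hA : ∀ i, 0 ≤ bzNum a i) :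
    nExpZ (a 3 + a 6 + 2 * a 7 - a 1 - a 2 - a 5) (eOfA a) (tOfA a) = ![0, a 6, a 0 + a 4 - a 2, a 0, a 1, 0, a 3, a 2, 0, 0] := by
  have a0 := hA 0; have a1 := hA 1; have a2 := hA 2; have a3 := hA 3; have a4 := hA 4; have a5 := hA 5
  have a6 := hA 6; have a7 := hA 7
  simp [bzNum] at a0 a1 a2 a3 a4 a5 a6 a7
  funext k
  fin_cases k <;> simp [nExpZ, eOfA, tOfA] <;> omega

/-- **`PhiZ (h₂₇ a) (e(a)) (t(a)) = dualConstantTerm a`** on the whole cone `bzNum a ≥ 0`, `bzDen a ≥ 0`. -/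
theorem PhiZ_eq_dualConstantTerm (a : Fin 8 → ℤ) (hA : ∀ i, 0 ≤ bzNum a i) (hB : ∀ i, 0 ≤ bzDen a i) :
    PhiZ (a 3 + a 6 + 2 * a 7 - a 1 - a 2 - a 5) (eOfA a) (tOfA a) = dualConstantTerm a := by
  have a0 := hA 0; have a1 := hA 1; have a2 := hA 2; have a3 := hA 3; have a6 := hA 6; have a7 := hA 7
  simp [bzNum] at a0 a1 a2 a3 a6 a7
  have hn : ∀ k, 0 ≤ nExpZ (a 3 + a 6 + 2 * a 7 - a 1 - a 2 - a 5) (eOfA a) (tOfA a) k := by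
    intro k; rw [nExpZ_eOfA a hA]; fin_cases k <;> simp <;> omega
  have hBv : ∀ w, 0 ≤ Bvec (eOfA a) (tOfA a) w := by
    intro w; rw [Bvec_eOfA a hA]; exact hB _
  have e1 : (Finsupp.equivFunOnFinite.symm fun w => (Bvec (eOfA a) (tOfA a) w).toNat) =
      Finsupp.equivFunOnFinite.symm fun w : Fin 6 => (bzDen a (Fin.castLE (by norm_num) w)).toNat := by
    rw [Bvec_eOfA a hA]
  have e2 : (fun k => (nExpZ (a 3 + a 6 + 2 * a 7 - a 1 - a 2 - a 5) (eOfA a) (tOfA a) k).toNat) =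
      ![0, (bzNum a 7).toNat, (bzNum a 6).toNat, (bzNum a 0).toNat, (bzNum a 1).toNat, 0, (bzNum a 3).toNat,
        (bzNum a 2).toNat, 0, 0] := by
    funext k; rw [nExpZ_eOfA a hA]; fin_cases k <;> simp [bzNum]
  rw [PhiZ_eq_coeff _ _ _ hn hBv, e1, e2]
  unfold dualConstantTerm
  rw [dualSpanProd_eq_tenProd]

/-- **D-exact on the whole cone**: for every `a ∈ ℤ⁸` with `bzNum a ≥ 0` and `bzDen a ≥ 0`,
`|Q(a)| = dualConstantTerm a`. -/
theorem dexact_cone (a : Fin 8 → ℤ) (hA : ∀ i, 0 ≤ bzNum a i) (hB : ∀ i, 0 ≤ bzDen a i) :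
    |QOf a| = dualConstantTerm a := by
  rw [DualQ.abs_QOf_eq_Gz a hA, Gz_eq_PhiZ, PhiZ_eq_dualConstantTerm a hA hB]

/-- **P2 g6's CONJECTURE D-exact (`Families/DualConstantTerm.LeadingCoeffIsDualConstantTerm`) holds.** -/
theorem leadingCoeffIsDualConstantTerm_holds : LeadingCoeffIsDualConstantTerm :=
  fun a hA hB => dexact_cone a hA hB

/-! ## The tree's consequences of D-exact, now unconditional -/

/-- `|Q(a)|·g^B ≤ Λ-numerator(g)` for every `a` in the cone and every `g ≥ 0`
(`DualConstantTermSum.abs_QOf_mul_prod_le_of_conjDexact`, discharged). -/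
theorem abs_QOf_mul_prod_le (a : Fin 8 → ℤ) (hA : ∀ i, 0 ≤ bzNum a i) (hB : ∀ i, 0 ≤ bzDen a i) (g : Fin 6 → ℝ)
    (hg : ∀ w, 0 ≤ g w) : (|QOf a| : ℝ) * ∏ w, g w ^ gapExp a w ≤ dualNumEval a g :=
  abs_QOf_mul_prod_le_of_conjDexact leadingCoeffIsDualConstantTerm_holds a hA hB g hg

/-- **`|Q(n·a)| ≤ Λ_a(g)ⁿ`** for every `a` in the cone, every `g > 0` and every `n` — the `limsup` half of P2's
Conjecture D (`DualConstantTermSum.abs_QOf_ray_le_of_conjDexact`, discharged). -/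
theorem abs_QOf_ray_le (a : Fin 8 → ℤ) (hA : ∀ i, 0 ≤ bzNum a i) (hB : ∀ i, 0 ≤ bzDen a i) (g : Fin 6 → ℝ)
    (hg : ∀ w, 0 < g w) (n : ℕ) :
    (|QOf (fun i => (n : ℤ) * a i)| : ℝ) ≤ (dualNumEval a g / ∏ w, g w ^ gapExp a w) ^ n :=
  abs_QOf_ray_le_of_conjDexact leadingCoeffIsDualConstantTerm_holds a hA hB g hg n

/-- **Gauss congruences along every ray of the cone**: `p^r ∣ |Q(m p^r a)| − |Q(m p^{r−1} a)|`
(`GaussCongruence.abs_QOf_ray_gauss_of_conjDexact`, discharged). -/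
theorem abs_QOf_ray_gauss (a : Fin 8 → ℤ) (hA : ∀ i, 0 ≤ bzNum a i) (hB : ∀ i, 0 ≤ bzDen a i) {p : ℕ}
    (hp : p.Prime) (m r : ℕ) :
    ((p : ℤ) ^ r) ∣ |QOf fun i => ((m * p ^ r : ℕ) : ℤ) * a i| - |QOf fun i => ((m * p ^ (r - 1) : ℕ) : ℤ) * a i| :=
  abs_QOf_ray_gauss_of_conjDexact leadingCoeffIsDualConstantTerm_holds a hA hB hp m r

end DualR

end Summit.KontsevichZagierPeriods.Zeta5Search.Families.Cellular
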